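import Mathlib
import Summits.ValiantsHypothesis.ValiantsHypothesis.Theorems.FeketeSOSCharPSparseSOSApproxShkredovBarrier

/-!
# Crux `FeketeSOS.CharPSparseSOS` (stmt-ValiantsHypothesis-14989) — the multi-piece barrier:
the quadratic residues are far from every near-packing by few restricted sumsets (from the crux)

For a prime `p` and pieces `Q_0, …, Q_{s'−1} ⊆ [0, p)` let
`r(n) = Σ_i #{a < b in Q_i : a + b ≡ n (mod p)}` be the total restricted pair-sum count and
`1_QR(n) = [n ≠ 0, (n|p) = 1]`; let `e = #{n < p : r(n) ≠ 1_QR(n)}`.  The fold identity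
`C_i² ≡ D_i + 2 ∑_n r_i(n) X^n (mod X^p − 1)` for each piece (`C_i = ∑_{a∈Q_i} X^a`,
`D_i = ∑_{a∈Q_i} X^{2a mod p}`), the Fekete pattern `F̄_p = 2 ∑_n 1_QR(n) X^n − (X + ⋯ + X^{p−1})`, the
digit tiling of the all-ones polynomial and the error polynomial give a cyclic representation of `F̄_p`
with `3s' + 6` squares
`F̄_p ≡ Σ_i (C_i² − ¼(1+D_i)² + ¼(1−D_i)²) − ¼(P+Q)² + ¼(P−Q)² − ¼(M+T)² + ¼(M−T)² − ½(1+Er)² + ½(1−Er)²`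
of degree `< p` and support-sum `≤ 3 Σ_i |Q_i| + 2s' + 2e + 6√p + 10` (`rnp_witness`).  Hence the crux
`CharPSparseSOS` (with exponent `δ`) forces, whenever `3s' + 6 ≤ p^δ`,
`p^{1/2+δ} ≤ 3 Σ_i |Q_i| + 2s' + 2e + 13√p + 13` (`rQs_far_from_QR_of_charPSparseSOS`): the one-piece
case `s' = 1` is `rQ_far_from_QR_of_charPSparseSOS` (p112874).  This is the kernel-checked form of the
PALEY SUM-CLIQUE PARTITION barrier of the crux memos (NOTES §I (♦), STRATEGY-CENSUS §0): a proof of the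
crux must exclude, for every `s' ≤ p^{δ}`, near-partitions of the quadratic residues into `s'` restricted
sumsets of sets of size `≍ √(p/s')` — for `s' ≥ 2` below every clique-type bound on record.
(Lead c6 of the crux; `--supports`.)
-/

-- `Summit.ValiantsHypothesis.ValiantsHypothesis.…` is the tree's mandated single-conjunct layout (Sub = Summit).
set_option linter.dupNamespace false

namespace Summit.ValiantsHypothesis.ValiantsHypothesis.Theorems.CharPSparseSOSTwoCusp

open Polynomial Finset
open Summit.ValiantsHypothesis.ValiantsHypothesis.Theorems.CharPSparseSOS.Negative
  (lowDigits highDigits card_support_add_le card_support_sub_le card_support_sum_le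
    card_support_sum_X_pow_le card_support_X_pow_le card_support_lowDigits card_support_highDigits
    natDegree_lowDigits natDegree_highDigits ones_digit_identity four_ne_zero_zmod)

noncomputable section

variable {K : Type} [Field K]

/-! ## The `(3s' + 6)`-square sum -/

/-- One patched diagonal: `−¼(1+D)² + ¼(1−D)² = −D` whenever `4 ≠ 0` in `K`. -/
theorem rnp_diag_pair (h4 : (4 : K) ≠ 0) (D : K[X]) :
    C (-1 / 4 : K) * (1 + D) ^ 2 + C (1 / 4 : K) * (1 - D) ^ 2 = -D := by
  have h4' : C (1 / 4 : K) * 4 = 1 := by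
    rw [show (4 : K[X]) = C 4 from (map_ofNat C 4).symm, ← C_mul, ← C_1]
    congr 1; exact one_div_mul_cancel h4
  have hneg : C (-1 / 4 : K) = -C (1 / 4 : K) := by
    rw [← map_neg]; congr 1; ring
  rw [hneg]
  linear_combination (-D) * h4'

/-- The six-square tail: `−¼(P+Q)² + ¼(P−Q)² − ¼(M+T)² + ¼(M−T)² − ½(1+E)² + ½(1−E)² = −(PQ + MT) − 2E`. -/
theorem rnp_tail_sum (h4 : (4 : K) ≠ 0) (P Q M T E : K[X]) :
    (∑ i, C ((![-1 / 4, 1 / 4, -1 / 4, 1 / 4, -1 / 2, 1 / 2] : Fin 6 → K) i) *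
        (![P + Q, P - Q, M + T, M - T, 1 + E, 1 - E] : Fin 6 → K[X]) i ^ 2) =
      -(P * Q + M * T) - 2 * E := by
  have h2 : (2 : K) ≠ 0 := fun h => h4 (by rw [show (4 : K) = 2 * 2 by norm_num, h, mul_zero])
  have h4' : C (1 / 4 : K) * 4 = 1 := by
    rw [show (4 : K[X]) = C 4 from (map_ofNat C 4).symm, ← C_mul, ← C_1]
    congr 1; exact one_div_mul_cancel h4
  have h2' : C (1 / 2 : K) * 2 = 1 := by
    rw [show (2 : K[X]) = C 2 from (map_ofNat C 2).symm, ← C_mul, ← C_1]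
    congr 1; exact one_div_mul_cancel h2
  have hneg : C (-1 / 4 : K) = -C (1 / 4 : K) := by
    rw [← map_neg]; congr 1; ring
  have hneg2 : C (-1 / 2 : K) = -C (1 / 2 : K) := by
    rw [← map_neg]; congr 1; ring
  simp only [Fin.sum_univ_succ, Fin.sum_univ_zero, Matrix.cons_val_zero, Matrix.cons_val_succ, hneg,
    hneg2, add_zero]
  linear_combination (-(P * Q + M * T)) * h4' + (-(2 * E)) * h2'

/-- **The `(3s' + 6)`-square sum.**  With weights `1` (on `C_i`), `−¼` (on `1 + D_i`), `¼` (on `1 − D_i`)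
and the six-square tail,
`Σ c_j g_j² = Σ_i C_i² − Σ_i D_i − (PQ + MT) − 2E` whenever `4 ≠ 0` in `K`. -/
theorem rnp_multi_sum (h4 : (4 : K) ≠ 0) (s' : ℕ) (Cq Dq : Fin s' → K[X]) (P Q M T E : K[X]) :
    (∑ j, C ((Fin.append (Fin.append (Fin.append (fun _ : Fin s' => (1 : K))
          (fun _ : Fin s' => (-1 / 4 : K))) (fun _ : Fin s' => (1 / 4 : K)))
          (![-1 / 4, 1 / 4, -1 / 4, 1 / 4, -1 / 2, 1 / 2] : Fin 6 → K)) j) *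
        (Fin.append (Fin.append (Fin.append Cq (fun i => 1 + Dq i)) (fun i => 1 - Dq i))
          (![P + Q, P - Q, M + T, M - T, 1 + E, 1 - E] : Fin 6 → K[X])) j ^ 2) =
      (∑ i, Cq i ^ 2) - (∑ i, Dq i) - (P * Q + M * T) - 2 * E := by
  rw [Fin.sum_univ_add, Fin.sum_univ_add, Fin.sum_univ_add]
  simp only [Fin.append_left, Fin.append_right]
  rw [rnp_tail_sum h4, C_1]
  have hpair : (∑ i : Fin s', C (-1 / 4 : K) * (1 + Dq i) ^ 2) +
      ∑ i : Fin s', C (1 / 4 : K) * (1 - Dq i) ^ 2 = -∑ i, Dq i := by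
    rw [← sum_add_distrib, ← sum_neg_distrib]
    exact sum_congr rfl fun i _ => rnp_diag_pair h4 (Dq i)
  have h1 : (∑ i : Fin s', (1 : K[X]) * Cq i ^ 2) = ∑ i, Cq i ^ 2 :=
    sum_congr rfl fun i _ => one_mul _
  rw [h1, add_assoc (∑ i, Cq i ^ 2), hpair]
  ring

/-! ## The `(3s' + 6)`-square witness -/

/-- **The multi-piece witness.**  Let `Q_i ⊆ [0, N]` (`i < s'`), `N + 1` prime, `u_i` the restricted
pair-sum counts of the pieces (all that is used: the fold identities
`C_i² ≡ D_i + 2 ∑ u_i(n) X^n (mod X^{N+1} − 1)`), `v` the indicator of the non-zero quadratic residues,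
`e ≥ #{n ≤ N : Σ_i u_i(n) ≠ v(n)}` and `N = ab + r` a tiling (`1 ≤ r`, `a ≤ N`).  Then there is a cyclic
representation of `F̄_{N+1}` with `s' + s' + s' + 6` squares of degree `< N + 1` and support-sum
`≤ 3 Σ_i |Q_i| + 2 s' + 2(a + b + r) + 2e + 6`. -/
theorem rnp_witness (N : ℕ) [Fact (N + 1).Prime] (h4 : (4 : K) ≠ 0) (s' : ℕ)
    (Qs : Fin s' → Finset ℕ) (hQ : ∀ i, ∀ x ∈ Qs i, x < N + 1) (u : Fin s' → ℕ → ℕ) (v : ℕ → ℕ)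
    (hfold : ∀ i, (X : K[X]) ^ (N + 1) - 1 ∣ (∑ x ∈ Qs i, (X : K[X]) ^ x) ^ 2 -
      (∑ x ∈ Qs i, (X : K[X]) ^ ((2 * x) % (N + 1)) +
        2 * ∑ n ∈ range (N + 1), (u i n : K[X]) * X ^ n))
    (hv : ∀ n, v n = if n ≠ 0 ∧ legendreSym (N + 1) n = 1 then 1 else 0)
    (e : ℕ) (he : ((range (N + 1)).filter (fun n => (∑ i, u i n) ≠ v n)).card ≤ e)
    (a b r : ℕ) (hN : N = a * b + r) (hr : 1 ≤ r) (ha : a ≤ N) :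
    ∃ (c : Fin (s' + s' + s' + 6) → K) (g : Fin (s' + s' + s' + 6) → K[X]),
      (∀ j, (g j).natDegree < N + 1) ∧
      ((X : K[X]) ^ (N + 1) - 1 ∣ (∑ j, C (c j) * g j ^ 2) -
        ∑ m ∈ range (N + 1), C ((legendreSym (N + 1) m : ℤ) : K) * X ^ m) ∧
      (∑ j, ((g j).support.card : ℝ)) ≤
        3 * (∑ i, ((Qs i).card : ℝ)) + 2 * s' + 2 * (a + b + r) + 2 * e + 6 := by
  have hE : (∑ n ∈ range (N + 1), ((∑ i, u i n : ℕ) : K[X]) * X ^ n) -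
      (∑ n ∈ range (N + 1), (v n : K[X]) * X ^ n) =
        ∑ n ∈ range (N + 1), C (((∑ i, u i n : ℕ) : K) - (v n : K)) * X ^ n :=
    rqf_err_poly_eq (K := K) (range (N + 1)) (fun n => ∑ i, u i n) v
  obtain ⟨Er, hEr⟩ : ∃ Er : K[X], Er = ∑ n ∈ range (N + 1), C (((∑ i, u i n : ℕ) : K) - (v n : K)) * X ^ n :=
    ⟨_, rfl⟩
  have hEc' : Er.support.card ≤ e := by
    rw [hEr]
    exact (rqf_card_support_err_le (K := K) (range (N + 1)) (fun n => ∑ i, u i n) v).trans he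
  obtain ⟨Cq, hCq⟩ : ∃ Cq : Fin s' → K[X], Cq = fun i => ∑ x ∈ Qs i, X ^ x := ⟨_, rfl⟩
  obtain ⟨Dq, hDq⟩ : ∃ Dq : Fin s' → K[X], Dq = fun i => ∑ x ∈ Qs i, X ^ ((2 * x) % (N + 1)) :=
    ⟨_, rfl⟩
  obtain ⟨M, hM⟩ : ∃ M : K[X], M = X ^ (a * b + 1) := ⟨_, rfl⟩
  obtain ⟨T, hT⟩ : ∃ T : K[X], T = ∑ k ∈ range r, X ^ k := ⟨_, rfl⟩
  refine ⟨Fin.append (Fin.append (Fin.append (fun _ : Fin s' => (1 : K))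
          (fun _ : Fin s' => (-1 / 4 : K))) (fun _ : Fin s' => (1 / 4 : K)))
          (![-1 / 4, 1 / 4, -1 / 4, 1 / 4, -1 / 2, 1 / 2] : Fin 6 → K),
    Fin.append (Fin.append (Fin.append Cq (fun i => 1 + Dq i)) (fun i => 1 - Dq i))
      (![lowDigits K a + highDigits K a b, lowDigits K a - highDigits K a b, M + T, M - T,
        1 + Er, 1 - Er] : Fin 6 → K[X]), ?_, ?_, ?_⟩
  · -- degrees
    have hC : ∀ i, (∑ x ∈ Qs i, (X : K[X]) ^ x).natDegree ≤ N := fun i =>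
      natDegree_sum_le_of_forall_le _ _ fun x hx => (natDegree_X_pow_le _).trans (by
        have := hQ i x hx; omega)
    have hD : ∀ i, (∑ x ∈ Qs i, (X : K[X]) ^ ((2 * x) % (N + 1))).natDegree ≤ N := fun i =>
      natDegree_sum_le_of_forall_le _ _ fun x _ => (natDegree_X_pow_le _).trans (by
        have := Nat.mod_lt (2 * x) (show 0 < N + 1 by omega); omega)
    have hl : (lowDigits K a).natDegree ≤ N := (natDegree_lowDigits a).trans ha
    have hh : (highDigits K a b).natDegree ≤ N :=
      (natDegree_highDigits a b).trans (le_trans (Nat.mul_le_mul_left a (Nat.sub_le b 1)) (by omega))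
    have hM' : M.natDegree ≤ N := by rw [hM]; exact (natDegree_X_pow_le _).trans (by omega)
    have hT' : T.natDegree ≤ N := by
      rw [hT]
      exact natDegree_sum_le_of_forall_le _ _ fun k hk => (natDegree_X_pow_le _).trans (by
        have := mem_range.mp hk; omega)
    have hEd : Er.natDegree ≤ N := by
      rw [hEr]
      exact natDegree_sum_le_of_forall_le _ _ fun n hn => (natDegree_C_mul_X_pow_le _ _).trans (by
        have := mem_range.mp hn; omega)
    have h1 : (1 : K[X]).natDegree ≤ N := by simp
    have hC' : ∀ i, (Cq i).natDegree ≤ N := fun i => by rw [hCq]; exact hC i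
    have hD' : ∀ i, (Dq i).natDegree ≤ N := fun i => by rw [hDq]; exact hD i
    intro j
    refine Nat.lt_succ_of_le ?_
    induction j using Fin.addCases with
    | left j =>
      rw [Fin.append_left]
      induction j using Fin.addCases with
      | left j =>
        rw [Fin.append_left]
        induction j using Fin.addCases with
        | left j => rw [Fin.append_left]; exact hC' j
        | right j => rw [Fin.append_right]; exact (natDegree_add_le _ _).trans (max_le h1 (hD' j))
      | right j => rw [Fin.append_right]; exact (natDegree_sub_le _ _).trans (max_le h1 (hD' j))
    | right j =>
      rw [Fin.append_right]
      fin_cases j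
      · exact (natDegree_add_le _ _).trans (max_le hl hh)
      · exact (natDegree_sub_le _ _).trans (max_le hl hh)
      · exact (natDegree_add_le _ _).trans (max_le hM' hT')
      · exact (natDegree_sub_le _ _).trans (max_le hM' hT')
      · exact (natDegree_add_le _ _).trans (max_le h1 hEd)
      · exact (natDegree_sub_le _ _).trans (max_le h1 hEd)
  · -- the cyclic identity: `Σ_i C_i² − Σ_i D_i − ones − 2 Er − (2 V − ones) = Σ_i (C_i² − D_i − 2 U_i)`
    have hsum : (X : K[X]) ^ (N + 1) - 1 ∣ ∑ i, ((∑ x ∈ Qs i, (X : K[X]) ^ x) ^ 2 -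
        (∑ x ∈ Qs i, (X : K[X]) ^ ((2 * x) % (N + 1)) +
          2 * ∑ n ∈ range (N + 1), (u i n : K[X]) * X ^ n)) :=
      dvd_sum fun i _ => hfold i
    have hU : (∑ n ∈ range (N + 1), (((∑ i, u i n : ℕ) : K[X])) * X ^ n) =
        ∑ i, ∑ n ∈ range (N + 1), (u i n : K[X]) * X ^ n := by
      rw [sum_comm]
      refine sum_congr rfl fun n _ => ?_
      rw [Nat.cast_sum, sum_mul]
    rw [rnp_multi_sum h4, hM, hT, ← ones_digit_identity a b r, ← hN, rqf_fekete_eq (N + 1) v hv,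
      Nat.add_sub_cancel]
    convert hsum using 1
    rw [hEr, ← hE, hU, sum_sub_distrib, sum_add_distrib, ← mul_sum, hCq, hDq]
    ring
  · -- support-sum bookkeeping
    have hC : ∀ i, ((Cq i).support.card : ℝ) ≤ (Qs i).card := fun i => by
      rw [hCq]; exact_mod_cast card_support_sum_X_pow_le (Qs i) (fun x => x)
    have hD : ∀ i, ((Dq i).support.card : ℝ) ≤ (Qs i).card := fun i => by
      rw [hDq]; exact_mod_cast card_support_sum_X_pow_le (Qs i) (fun x => (2 * x) % (N + 1))
    have hM' : (M.support.card : ℝ) ≤ 1 := by rw [hM]; exact_mod_cast card_support_X_pow_le _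
    have hT' : (T.support.card : ℝ) ≤ r := by
      have : T.support.card ≤ r := by
        rw [hT]; exact (card_support_sum_X_pow_le (range r) id).trans (by simp)
      exact_mod_cast this
    have hl : ((lowDigits K a).support.card : ℝ) ≤ a := by exact_mod_cast card_support_lowDigits a
    have hh : ((highDigits K a b).support.card : ℝ) ≤ b := by
      exact_mod_cast card_support_highDigits a b
    have hEc : (Er.support.card : ℝ) ≤ e := by exact_mod_cast hEc'
    have h1 : ((1 : K[X]).support.card : ℝ) ≤ 1 := by
      have := card_support_X_pow_le (K := K) 0
      rw [pow_zero] at this; exact_mod_cast this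
    have hadd := fun (A B : K[X]) => (Nat.cast_le (α := ℝ)).2 (card_support_add_le A B)
    have hsub := fun (A B : K[X]) => (Nat.cast_le (α := ℝ)).2 (card_support_sub_le A B)
    -- the three families
    have hfam1 : (∑ i, ((Cq i).support.card : ℝ)) ≤ ∑ i, ((Qs i).card : ℝ) :=
      sum_le_sum fun i _ => hC i
    have hfam2 : (∑ i, (((1 : K[X]) + Dq i).support.card : ℝ)) ≤ ∑ i, (1 + ((Qs i).card : ℝ)) :=
      sum_le_sum fun i _ => by
        have := hadd 1 (Dq i); push_cast at this; linarith [hD i, h1]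
    have hfam3 : (∑ i, (((1 : K[X]) - Dq i).support.card : ℝ)) ≤ ∑ i, (1 + ((Qs i).card : ℝ)) :=
      sum_le_sum fun i _ => by
        have := hsub 1 (Dq i); push_cast at this; linarith [hD i, h1]
    have hconst : (∑ _i : Fin s', (1 + ((Qs _i).card : ℝ))) = s' + ∑ i, ((Qs i).card : ℝ) := by
      rw [sum_add_distrib, sum_const, card_univ, Fintype.card_fin, nsmul_eq_mul, mul_one]
    rw [hconst] at hfam2 hfam3
    -- the tail
    have e3 := hadd (lowDigits K a) (highDigits K a b)
    have e4 := hsub (lowDigits K a) (highDigits K a b)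
    have e5 := hadd M T
    have e6 := hsub M T
    have e7 := hadd 1 Er
    have e8 := hsub 1 Er
    push_cast at e3 e4 e5 e6 e7 e8
    rw [Fin.sum_univ_add, Fin.sum_univ_add, Fin.sum_univ_add]
    simp only [Fin.append_left, Fin.append_right, Fin.sum_univ_succ, Fin.sum_univ_zero,
      Matrix.cons_val_zero, Matrix.cons_val_succ, add_zero]
    linarith

/-! ## The barrier -/

/-- **Near-packings of the quadratic residues by few restricted sumsets are far from exact (from the
crux).**  `CharPSparseSOS` (with its exponent `δ`) implies: for all primes `p ≥ max p₀ 5` and all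
families `Q_0, …, Q_{s'−1} ⊆ [0, p)` with `s' + s' + s' + 6 ≤ p^δ`,
`p^{1/2+δ} ≤ 3 Σ_i |Q_i| + 2s' + 2·#{n < p : Σ_i r_{Q_i}(n) ≠ 1_QR(n)} + 13√p + 13`, where
`r_Q(n) = #{(a,b) ∈ Q × Q : a < b, a + b ≡ n (mod p)}` and `1_QR(n) = [n ≠ 0 ∧ (n|p) = 1]`: the witness
`rnp_witness` is a cyclic representation of `F̄_p` of degree `< p` with `s' + s' + s' + 6 ≤ p^δ` squares
and support-sum `≤ 3 Σ|Q_i| + 2s' + 2e + 6√p + 10`.  The case `s' = 1` is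
`rQ_far_from_QR_of_charPSparseSOS`; for `s' ≥ 2` pieces of size `≍ √(p/s')` lie below every Paley
clique-type bound on record (crux NOTES §I, STRATEGY-CENSUS §0). -/
theorem rQs_far_from_QR_of_charPSparseSOS :
    Summit.ValiantsHypothesis.ValiantsHypothesis.Theses.FeketeSOS.CharPSparseSOS →
      ∃ δ : ℝ, 0 < δ ∧ ∃ p₁ : ℕ, ∀ (p : ℕ) [Fact p.Prime], p₁ ≤ p →
        ∀ (s' : ℕ) (Qs : Fin s' → Finset ℕ), (∀ i, ∀ a ∈ Qs i, a < p) →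
        (((s' + s' + s' + 6 : ℕ) : ℝ) ≤ (p : ℝ) ^ δ) →
        (p : ℝ) ^ (1 / 2 + δ) ≤ 3 * (∑ i, ((Qs i).card : ℝ)) + 2 * s' +
          2 * (((Finset.range p).filter (fun n => (∑ i, ((Qs i ×ˢ Qs i).filter
              (fun ab : ℕ × ℕ => ab.1 < ab.2 ∧ (ab.1 + ab.2) % p = n)).card) ≠
                (if n ≠ 0 ∧ legendreSym p n = 1 then 1 else 0))).card : ℝ) +
          13 * Real.sqrt p + 13 := by
  rintro ⟨δ, hδ, p₀, hmain⟩
  refine ⟨δ, hδ, max p₀ 5, ?_⟩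
  intro p _ hp s' Qs hQ hs
  have hpprime : p.Prime := Fact.out
  have hp5 : 5 ≤ p := le_of_max_le_right hp
  have hp₀ : p₀ ≤ p := le_of_max_le_left hp
  have h4 : (4 : ZMod p) ≠ 0 := four_ne_zero_zmod p hp5
  obtain ⟨N, rfl⟩ : ∃ N, p = N + 1 := ⟨p - 1, (Nat.succ_pred_eq_of_pos hpprime.pos).symm⟩
  -- digits of N = p - 1 (as in `rQ_far_from_QR_of_charPSparseSOS`): N = a * b + r, 1 ≤ r ≤ a
  set a := Nat.sqrt N with ha
  set b := (N - 1) / a with hb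
  set r := N - a * b with hr
  have hN4 : 4 ≤ N := by omega
  have ha1 : 1 ≤ a := by rw [ha]; exact Nat.le_sqrt.mpr (by nlinarith)
  have hdm : N - 1 = a * b + (N - 1) % a := by rw [hb]; exact (Nat.div_add_mod (N - 1) a).symm
  have hmod : (N - 1) % a < a := Nat.mod_lt _ ha1
  have hNabr : N = a * b + r := by omega
  have hr1 : 1 ≤ r := by omega
  have hra : r ≤ a := by omega
  have haa : a * a ≤ N := by rw [ha]; exact Nat.sqrt_le N
  have hNlt : N < (a + 1) * (a + 1) := by rw [ha]; exact Nat.lt_succ_sqrt N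
  have hb_le : b ≤ a + 2 := by
    rw [hb]
    have : N - 1 ≤ a * (a + 2) := by
      have : N ≤ a * (a + 2) := by nlinarith
      omega
    calc (N - 1) / a ≤ (a * (a + 2)) / a := Nat.div_le_div_right this
      _ = a + 2 := Nat.mul_div_cancel_left _ ha1
  have haN : a ≤ N := (Nat.le_mul_self a).trans haa
  -- the crux applied to the multi-piece witness
  obtain ⟨c, g, hdeg, hdvd, hsupp⟩ := rnp_witness N h4 s' Qs hQ
    (fun i n => ((Qs i ×ˢ Qs i).filter
      (fun ab : ℕ × ℕ => ab.1 < ab.2 ∧ (ab.1 + ab.2) % (N + 1) = n)).card)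
    (fun n => if n ≠ 0 ∧ legendreSym (N + 1) n = 1 then 1 else 0)
    (fun i => rqf_fold_identity (N + 1) (Nat.succ_pos N) (Qs i)) (fun n => rfl)
    (((range (N + 1)).filter (fun n => (∑ i, ((Qs i ×ˢ Qs i).filter
        (fun ab : ℕ × ℕ => ab.1 < ab.2 ∧ (ab.1 + ab.2) % (N + 1) = n)).card) ≠
          (if n ≠ 0 ∧ legendreSym (N + 1) n = 1 then 1 else 0))).card) le_rfl
    a b r hNabr hr1 haN
  have key := hmain (N + 1) hp₀ (ZMod (N + 1)) (s' + s' + s' + 6) c g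
  have hbound := key hs hdeg hdvd
  -- bookkeeping: 2(a + b + r) + 6 ≤ 6a + 10 ≤ 6√p + 10 ≤ 13√p + 13
  have hb' : (b : ℝ) ≤ a + 2 := by exact_mod_cast hb_le
  have hr' : (r : ℝ) ≤ a := by exact_mod_cast hra
  have hsqrt : (a : ℝ) ≤ Real.sqrt ((N + 1 : ℕ) : ℝ) := by
    rw [← Real.sqrt_sq (Nat.cast_nonneg a)]
    apply Real.sqrt_le_sqrt
    have : ((a * a : ℕ) : ℝ) ≤ ((N + 1 : ℕ) : ℝ) := by exact_mod_cast haa.trans (Nat.le_succ N)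
    push_cast at this ⊢; nlinarith
  have hsq0 : (0 : ℝ) ≤ Real.sqrt ((N + 1 : ℕ) : ℝ) := Real.sqrt_nonneg _
  linarith

end

end Summit.ValiantsHypothesis.ValiantsHypothesis.Theorems.CharPSparseSOSTwoCusp
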